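import Literature.MathematicalPhysics.QuantumFieldTheory.BalabanImbrieJaffe1984to88.BIJ88Eq531SmallAPrime

/-!
# `BalabanImbrieJaffe1984to88.BIJ88Eq531SmallF` — T. Bałaban, J. Imbrie, A. Jaffe, *Effective action and cluster properties of the
abelian Higgs model*, Commun. Math. Phys. **114** (1988) 257–315 [BalabanImbrieJaffe1988], p. 280, the second sentence after **(5.3.1)**:
*"Let us define f(p) = (ie_k)^{−1} log v(p). The restrictions on u(p) and the fact that v = Qu imply that |f(p)| ≦ cp(e_k) for
p ∈ Λ₀^{(k)′*}."* — PROVED on the torus carrier of record, one renormalization step, constant explicit (`c = L² + 4N₃ ≤ 17d²L²`),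
for the objects of record: the block average `v = Qu` of [BalabanImbrieJaffe1985] (2.10)–(2.11) (r18's `BIJ85BlockAveragesTorus.qU`),
the axial gauge `δ_{Ax}` of (3.11) (r18's `BIJ88RenormTransf311.DeltaAx`), the field strength `f = (ie_k)^{−1} log` of (3.26) (r18's
`BIJ88Sect3Statements.fieldStrength`), and r16's asserted predicate `BIJ88Sect5StatementsPart3.SmallF` (row C2.Eq5.3.1-5.3.7), here
DISCHARGED.  Companion of `BIJ88Eq531SmallAPrime` (the first sentence, `|A′_b| ≦ cp(e_k)`).

statement-level skeleton of published theorems with citation tags; proofs where landed; nothing here is a claim about the Yang–Mills mass gap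

PDF held: `paper:balaban1988-cmp114-bij-abelian-higgs-effective-action` (journal page = PDF page + 256), p. 280 [PDF 24] read as the image
`HOME/lit-balaban-r16/renders/cmp114/original-p024-x2.png` (this seat, gen 5); [BalabanImbrieJaffe1985]
(`paper:balaban1985-cmp97-bij-higgs-minimizers`) p. 303 [PDF 5] ((2.10)–(2.11)).

CITATION HEADER (lean-in-tree rule).  Part of the lit-balaban TYPED SKELETON (HOME `run/shared/lean/pub/lit-balaban/`), PHASE-2 proof
seat p31 gen 5 (unit `lit-balaban-p31-g5`), file 5 of the gen, after `BIJ88Eq531SmallAPrime` (p254183).  WHAT IS REPRODUCED: the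
*"v = Qu"* mechanism behind *"|f(p)| ≦ cp(e_k)"*, which the paper does not spell out:
* §2 **ABELIAN LATTICE STOKES** (`rect_stokes`): for the `U(1)` field read in `ℂ`, the product of the plaquette variables of the `s × t`
  fine plaquettes of a lattice rectangle equals the product of the bond variables around its boundary (rows `row_stokes`, then columns).
* §3 **THE COARSE PLAQUETTE OF `v = Qu`** (`toC_plaqHol_qU`, no gauge condition needed): for the `L`-lattice plaquette
  `p′ = ⟨y; μ, ν⟩`, by (2.10) `(Qu)_{yy′} = u(Γ_{yy′})·e^{i·avg_{yy′}}` and `Γ_{y,y+e_μ}` is the straight run of `L` unit bonds from the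
  corner `yL` (r18's `corner_shift`), so **`v(∂p′) = [∏_{L² fine plaquettes of the corner square of B(y)} u(∂p)] ·
  e^{i(avg₁ + avg₂ − avg₃ − avg₄)}`** — Stokes on the `L × L` square with corners `yL, (y+e_μ)L, (y+e_μ+e_ν)L, (y+e_ν)L`.
* §4 **THE BOUND** (`abs_argB_plaqHol_qU_le`): in the axial gauge, with `|argB u(∂p)| ≤ ε` on the plaquettes of the four blocks
  `B(y), B(y+e_μ), B(y+e_ν), B(y+e_μ+e_ν)` and `(L² + 4N₃)ε < π`: **`|argB v(∂p′)| ≤ (L² + 4N₃)ε`** (`N₃ = (L−1)N₁ + N₁(1+2N₁)`,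
  `N₁ = (d−1)(L−1)`, the loop constant of `BIJ88Eq531SmallAPrime.abs_loopAvg_le`).
* §5 **`|f(p′)| ≦ cp(e_k)`** (`norm_fieldStrength_eq`, `smallF_of_plaquettes`): `‖(ie_k)^{−1} log v(p′)‖ = |argB v(∂p′)|/e_k ≤ c·p(e_k)`
  with `ε = e_kp(e_k)`, `c = 17d²L² ≥ L² + 4N₃` — r16's `SmallF (17d²L²) p(e_k) e_k Λ₀′ (p′ ↦ v(∂p′))` DISCHARGED from the plaquette
  restrictions on the blocks around `Λ₀′**` and `δ_{Ax}`.
§1 is lattice bookkeeping (runs in two directions commute; the corner square lies in `B(y)`).  No `def`s, no new `def … : Prop`, no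
notations.  Axioms: {propext, Classical.choice, Quot.sound}.  Unit `lit-balaban-p31` gen 5 (literature-prover-lit-balaban-p31-g5-0), 2026-08-21.
-/

namespace Literature.MathematicalPhysics.QuantumFieldTheory.BalabanImbrieJaffe1984to88.BIJ88Eq531SmallF

open Literature.MathematicalPhysics.QuantumFieldTheory.Balaban1983to89
open BIJ88Sect3Statements (U1 toC toC_mul toC_one norm_toC cfg fieldStrength starP)
open BIJ85Sect1Model (argB argB_mem_Ico)
open BIJ85SmallFieldSplit64 (argB_exp_mul_I argB_eq_arg)
open BIJ88RenormTransf311 (inBlock IsAxialBond axialBonds mem_axialBonds DeltaAx)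
open BIJ85BlockAveragesTorus
open BIJ88Eq531SmallAPrime
open GaugeField (plaqHol)
open scoped BigOperators Real
open Complex Finset

noncomputable section

variable {P : Params} {j : ℕ}

/-! ## §1  Runs in two directions -/

/-- kernel: one step of a run is a shift, `x + 1·e_μ = x + e_μ`. [cite: BalabanImbrieJaffe1985, (2.10) p.303] -/
theorem runSite_one (x : Balaban1983to89.Site P j) (μ : Fin P.d) : runSite x μ 1 = x.shift μ := by
  simp only [runSite, Balaban1983to89.Site.shift, Nat.cast_one]

/-- kernel: runs in two different directions commute, `(x + se_μ) + te_ν = (x + te_ν) + se_μ`. [cite: BalabanImbrieJaffe1985, (2.10) p.303] -/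
theorem runSite_comm {μ ν : Fin P.d} (h : μ ≠ ν) (x : Balaban1983to89.Site P j) (s t : ℕ) :
    runSite (runSite x μ s) ν t = runSite (runSite x ν t) μ s := by
  simp only [runSite, Function.update_of_ne h.symm, Function.update_of_ne h]
  exact Function.update_comm h _ _ _

/-- kernel: `(x + se_μ) + e_ν = (x + e_ν) + se_μ` for `μ ≠ ν`. [cite: BalabanImbrieJaffe1985, (2.10) p.303] -/
theorem shift_runSite_comm {μ ν : Fin P.d} (h : μ ≠ ν) (x : Balaban1983to89.Site P j) (s : ℕ) :
    (runSite x μ s).shift ν = runSite (x.shift ν) μ s := by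
  rw [← runSite_one, ← runSite_one, runSite_comm h]

/-- kernel: shifts commute, `x + e_μ + e_ν = x + e_ν + e_μ`. [cite: BalabanImbrieJaffe1985, (2.5) p.302] -/
theorem shift_shift_comm (x : Balaban1983to89.Site P j) (μ ν : Fin P.d) : (x.shift μ).shift ν = (x.shift ν).shift μ := by
  by_cases h : μ = ν
  · rw [h]
  · rw [← runSite_one, ← runSite_one, ← runSite_one (x.shift ν), ← runSite_one x ν, runSite_comm h]

/-- kernel: **the corner square lies in the block** — the sites `yL + be_ν + ae_μ`, `a, b < L`, are in `B(y)`.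
[cite: BalabanImbrieJaffe1985, (2.4) p.302] -/
theorem blockOf_cornerSquare (hj : j + 1 ≤ P.m + P.K) (y : Balaban1983to89.Site P (j+1)) {μ ν : Fin P.d} (h : μ ≠ ν) {a b : ℕ}
    (ha : a < P.L) (hb : b < P.L) : blockOf (runSite (runSite (corner y) ν b) μ a) = y := by
  have hr : ((Function.update (fun _ => (⟨0, P.L_pos⟩ : Fin P.L)) ν ⟨b, hb⟩ μ : Fin P.L) : ℕ) + a < P.L := by
    rw [Function.update_of_ne h]
    simpa using ha
  rw [runSite_corner y ν b hb, runSite_blockSite_lo hj y _ μ hr, Balaban1983to89.Site.blockOf_blockSite hj]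

/-! ## §2  Abelian lattice Stokes for the `U(1)` field read in `ℂ` -/

/-- kernel: a product of bond variables read in `ℂ` is non-zero. [cite: BalabanImbrieJaffe1985, (2.5) p.302] -/
theorem prod_toC_ne_zero {ι : Type*} (s : Finset ι) (f : ι → U1) : ∏ i ∈ s, toC (f i) ≠ 0 :=
  prod_ne_zero_iff.2 fun _ _ => toC_ne_zero _

/-- **Stokes for a row of plaquettes.**  The product of the plaquette variables `u(∂p)`, `p = ⟨z + ae_μ; μ, ν⟩`, `a < s`, equals
`u(z → z + se_μ) · u⟨z + se_μ, ν⟩ · u(z + e_ν → z + e_ν + se_μ)^{−1} · u⟨z, ν⟩^{−1}` (abelian group: the inner `ν`-bonds cancel).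
[cite: BalabanImbrieJaffe1985, (2.10) p.303] -/
theorem row_stokes (U : GaugeField P j U1) (z : Balaban1983to89.Site P j) {μ ν : Fin P.d} (hμν : μ < ν) (s : ℕ) :
    ∏ a ∈ range s, toC (plaqHol U ⟨runSite z μ a, μ, ν, hμν⟩) =
      (∏ a ∈ range s, toC (U ⟨runSite z μ a, μ⟩)) * toC (U ⟨runSite z μ s, ν⟩) *
        (∏ a ∈ range s, toC (U ⟨runSite (z.shift ν) μ a, μ⟩))⁻¹ * (toC (U ⟨z, ν⟩))⁻¹ := by
  induction s with
  | zero => simp [mul_inv_cancel₀ (toC_ne_zero _)]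
  | succ s ih =>
    rw [prod_range_succ, prod_range_succ, prod_range_succ, ih, toC_plaqHol]
    dsimp only
    rw [runSite_shift, shift_runSite_comm (ne_of_lt hμν)]
    have h1 := toC_ne_zero (U ⟨runSite z μ s, ν⟩)
    have h2 := toC_ne_zero (U ⟨z, ν⟩)
    have h3 := toC_ne_zero (U ⟨runSite (z.shift ν) μ s, μ⟩)
    have h4 := prod_toC_ne_zero (range s) (fun a => U ⟨runSite (z.shift ν) μ a, μ⟩)
    field_simp

/-- **Abelian lattice Stokes for a rectangle.**  The product of the plaquette variables of the `s × t` plaquettes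
`⟨x + be_ν + ae_μ; μ, ν⟩`, `a < s`, `b < t`, equals the product of the bond variables around the boundary of the rectangle with
corners `x, x + se_μ, x + se_μ + te_ν, x + te_ν` (counter-clockwise, `μ < ν`). [cite: BalabanImbrieJaffe1985, (2.10) p.303] -/
theorem rect_stokes (U : GaugeField P j U1) (x : Balaban1983to89.Site P j) {μ ν : Fin P.d} (hμν : μ < ν) (s t : ℕ) :
    ∏ b ∈ range t, ∏ a ∈ range s, toC (plaqHol U ⟨runSite (runSite x ν b) μ a, μ, ν, hμν⟩) =
      (∏ a ∈ range s, toC (U ⟨runSite x μ a, μ⟩)) * (∏ b ∈ range t, toC (U ⟨runSite (runSite x μ s) ν b, ν⟩)) *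
        (∏ a ∈ range s, toC (U ⟨runSite (runSite x ν t) μ a, μ⟩))⁻¹ * (∏ b ∈ range t, toC (U ⟨runSite x ν b, ν⟩))⁻¹ := by
  have hne : μ ≠ ν := ne_of_lt hμν
  induction t with
  | zero =>
    have h := prod_toC_ne_zero (range s) (fun a => U ⟨runSite x μ a, μ⟩)
    simp [mul_inv_cancel₀ h]
  | succ t ih =>
    rw [prod_range_succ, ih, row_stokes U (runSite x ν t) hμν s, runSite_shift x ν t, ← runSite_comm hne x s t,
      prod_range_succ (fun b => toC (U ⟨runSite (runSite x μ s) ν b, ν⟩)),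
      prod_range_succ (fun b => toC (U ⟨runSite x ν b, ν⟩))]
    have h1 := prod_toC_ne_zero (range s) (fun a => U ⟨runSite (runSite x ν t) μ a, μ⟩)
    have h2 := prod_toC_ne_zero (range t) (fun b => U ⟨runSite x ν b, ν⟩)
    have h3 := prod_toC_ne_zero (range s) (fun a => U ⟨runSite (runSite x ν (t + 1)) μ a, μ⟩)
    have h4 := toC_ne_zero (U ⟨runSite x ν t, ν⟩)
    have h5 := toC_ne_zero (U ⟨runSite (runSite x μ s) ν t, ν⟩)
    field_simp

/-! ## §3  The coarse plaquette variable of `v = Qu` -/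

/-- kernel: `e^{ia}e^{ib}(e^{ic})^{−1}(e^{id})^{−1} = e^{i(a+b−c−d)}`. [cite: BalabanImbrieJaffe1985, (2.10) p.303] -/
theorem exp_comb (a b c d : ℝ) :
    Complex.exp (((a + b - c - d : ℝ) : ℂ) * I) =
      Complex.exp (a * I) * Complex.exp (b * I) * (Complex.exp (c * I))⁻¹ * (Complex.exp (d * I))⁻¹ := by
  push_cast
  rw [sub_mul, sub_mul, add_mul, Complex.exp_sub, Complex.exp_sub, Complex.exp_add, div_eq_mul_inv, div_eq_mul_inv]

/-- **`v(∂p′)` for `v = Qu`, (2.10) around an `L`-lattice plaquette `p′ = ⟨y; μ, ν⟩`**: the four factors `u(Γ)` of (2.10) run around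
the square with corners `yL, (y+e_μ)L, (y+e_μ+e_ν)L, (y+e_ν)L`, so by the abelian Stokes theorem
**`v(∂p′) = [∏_{a,b<L} u(∂⟨yL + be_ν + ae_μ; μ, ν⟩)] · exp i(avg_{y,μ} + avg_{y+e_μ,ν} − avg_{y+e_ν,μ} − avg_{y,ν})`**, `avg` the
exponent `L^{−d}Σ_x argB u(loop_x)` of (2.10) (`loopAvg`).  No gauge condition is used. [cite: BalabanImbrieJaffe1985, (2.10) p.303] -/
theorem toC_plaqHol_qU (hj : j + 1 ≤ P.m + P.K) (U : GaugeField P j U1) (q : Balaban1983to89.Plaq P (j+1)) :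
    toC (plaqHol (qU U) q) =
      (∏ b ∈ range P.L, ∏ a ∈ range P.L, toC (plaqHol U ⟨runSite (runSite (corner q.src) q.ν b) q.μ a, q.μ, q.ν, q.hμν⟩)) *
        Complex.exp (((loopAvg U ⟨q.src, q.μ⟩ + loopAvg U ⟨q.src.shift q.μ, q.ν⟩ - loopAvg U ⟨q.src.shift q.ν, q.μ⟩ -
          loopAvg U ⟨q.src, q.ν⟩ : ℝ) : ℂ) * I) := by
  rw [toC_plaqHol, rect_stokes U (corner q.src) q.hμν P.L P.L, exp_comb]
  simp only [toC_qU]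
  rw [corner_shift hj, corner_shift hj]
  simp only [runC, runBond]
  ring

/-! ## §4  The bound `|argB v(∂p′)| ≤ (L² + 4N₃)ε` in the axial gauge -/

/-- kernel: the cardinality of the corner square read in `ℝ`. [cite: BalabanImbrieJaffe1985, (2.4) p.302] -/
theorem card_square_real : (((range P.L ×ˢ range P.L).card : ℕ) : ℝ) = (P.L : ℝ) ^ 2 := by
  rw [card_product, card_range]
  push_cast
  ring

/-- **THE BOUND ON `v(∂p′)`.**  In the axial gauge `δ_{Ax}(u)`, if `|argB u(∂p)| ≤ ε` on the plaquettes of the four blocks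
`B(y), B(y+e_μ), B(y+e_ν), B(y+e_μ+e_ν)` around the `L`-lattice plaquette `p′ = ⟨y; μ, ν⟩` and `(L² + 4N₃)ε < π`, then
**`|argB v(∂p′)| ≤ (L² + 4N₃)·ε`** for `v = Qu`: `L²` fine plaquettes of the corner square (Stokes) plus the four exponents of (2.10),
each `≤ N₃ε` (`BIJ88Eq531SmallAPrime.abs_loopAvg_le`), `N₃ = (L−1)(d−1)(L−1) + (d−1)(L−1)(1 + 2(d−1)(L−1))`.
[cite: BalabanImbrieJaffe1988, (5.3.1) p.280] -/
theorem abs_argB_plaqHol_qU_le (hj : j + 1 ≤ P.m + P.K) {U : GaugeField P j U1} (hU : DeltaAx U) {ε : ℝ} (hε₀ : 0 ≤ ε)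
    (q : Balaban1983to89.Plaq P (j+1))
    (hε : ∀ p : Balaban1983to89.Plaq P j, blockOf p.src = q.src ∨ blockOf p.src = q.src.shift q.μ ∨
      blockOf p.src = q.src.shift q.ν ∨ blockOf p.src = (q.src.shift q.μ).shift q.ν → |argB (toC (plaqHol U p))| ≤ ε)
    (hπ : ((P.L ^ 2 + 4 * ((P.L - 1) * ((P.d - 1) * (P.L - 1)) + (P.d - 1) * (P.L - 1) * (1 + 2 * ((P.d - 1) * (P.L - 1)))) : ℕ) : ℝ)
      * ε < π) :
    |argB (toC (plaqHol (qU U) q))| ≤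
      ((P.L ^ 2 + 4 * ((P.L - 1) * ((P.d - 1) * (P.L - 1)) + (P.d - 1) * (P.L - 1) * (1 + 2 * ((P.d - 1) * (P.L - 1)))) : ℕ) : ℝ)
        * ε := by
  have hne : q.μ ≠ q.ν := ne_of_lt q.hμν
  have hN : (0 : ℝ) ≤ (((P.L - 1) * ((P.d - 1) * (P.L - 1)) + (P.d - 1) * (P.L - 1) * (1 + 2 * ((P.d - 1) * (P.L - 1))) : ℕ) : ℝ) :=
    Nat.cast_nonneg _
  have hcast : ((P.L ^ 2 + 4 * ((P.L - 1) * ((P.d - 1) * (P.L - 1)) + (P.d - 1) * (P.L - 1) * (1 + 2 * ((P.d - 1) * (P.L - 1))))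
      : ℕ) : ℝ) = (P.L : ℝ) ^ 2 +
        4 * (((P.L - 1) * ((P.d - 1) * (P.L - 1)) + (P.d - 1) * (P.L - 1) * (1 + 2 * ((P.d - 1) * (P.L - 1))) : ℕ) : ℝ) := by
    push_cast
    ring
  rw [hcast] at hπ ⊢
  have hL2 : (0 : ℝ) ≤ (P.L : ℝ) ^ 2 * ε := by positivity
  have hπN : (((P.L - 1) * ((P.d - 1) * (P.L - 1)) + (P.d - 1) * (P.L - 1) * (1 + 2 * ((P.d - 1) * (P.L - 1))) : ℕ) : ℝ) * ε < π := by
    nlinarith [mul_nonneg hN hε₀]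
  -- the L² fine plaquettes of the corner square
  have hsq := abs_argB_prod_le (range P.L ×ˢ range P.L)
    (fun x => toC (plaqHol U ⟨runSite (runSite (corner q.src) q.ν x.1) q.μ x.2, q.μ, q.ν, q.hμν⟩)) hε₀
    (fun _ _ => norm_toC _)
    (fun x hx => by
      obtain ⟨hb, ha⟩ := mem_product.1 hx
      exact hε _ (Or.inl (blockOf_cornerSquare hj q.src hne (mem_range.1 ha) (mem_range.1 hb))))
    (by rw [card_square_real]; nlinarith [mul_nonneg hN hε₀])
  rw [card_square_real, prod_product] at hsq
  obtain ⟨hn, ha⟩ := hsq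
  -- the four exponents of (2.10)
  have h1 : |loopAvg U ⟨q.src, q.μ⟩| ≤ _ := abs_loopAvg_le hj hU hε₀ (y := q.src) (μ := q.μ)
    (fun p hp => hε p (hp.elim Or.inl fun h => Or.inr (Or.inl h))) hπN
  have h2 : |loopAvg U ⟨q.src.shift q.μ, q.ν⟩| ≤ _ := abs_loopAvg_le hj hU hε₀ (y := q.src.shift q.μ) (μ := q.ν)
    (fun p hp => hε p (hp.elim (fun h => Or.inr (Or.inl h)) fun h => Or.inr (Or.inr (Or.inr h)))) hπN
  have h3 : |loopAvg U ⟨q.src.shift q.ν, q.μ⟩| ≤ _ := abs_loopAvg_le hj hU hε₀ (y := q.src.shift q.ν) (μ := q.μ)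
    (fun p hp => hε p (by
      rcases hp with h | h
      · exact Or.inr (Or.inr (Or.inl h))
      · rw [← shift_shift_comm] at h; exact Or.inr (Or.inr (Or.inr h)))) hπN
  have h4 : |loopAvg U ⟨q.src, q.ν⟩| ≤ _ := abs_loopAvg_le hj hU hε₀ (y := q.src) (μ := q.ν)
    (fun p hp => hε p (hp.elim Or.inl fun h => Or.inr (Or.inr (Or.inl h)))) hπN
  have hθ : |loopAvg U ⟨q.src, q.μ⟩ + loopAvg U ⟨q.src.shift q.μ, q.ν⟩ - loopAvg U ⟨q.src.shift q.ν, q.μ⟩ - loopAvg U ⟨q.src, q.ν⟩|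
      ≤ 4 * ((((P.L - 1) * ((P.d - 1) * (P.L - 1)) + (P.d - 1) * (P.L - 1) * (1 + 2 * ((P.d - 1) * (P.L - 1))) : ℕ) : ℝ) * ε) := by
    -- `|a + b − c − d| ≤ |a| + |b| + |c| + |d|` (inlined; the tree has it as `…BoseGas.LiebLiniger.abs_add_sub_sub_le`, not imported here)
    have h4' : ∀ a b c d : ℝ, |a + b - c - d| ≤ |a| + |b| + |c| + |d| := fun a b c d =>
      calc |a + b - c - d| ≤ |a + b - c| + |d| := abs_sub _ _
        _ ≤ |a + b| + |c| + |d| := by gcongr; exact abs_sub _ _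
        _ ≤ |a| + |b| + |c| + |d| := by gcongr; exact abs_add_le _ _
    exact (h4' _ _ _ _).trans (by linarith)
  have hθπ : |loopAvg U ⟨q.src, q.μ⟩ + loopAvg U ⟨q.src.shift q.μ, q.ν⟩ - loopAvg U ⟨q.src.shift q.ν, q.μ⟩ - loopAvg U ⟨q.src, q.ν⟩|
      < π := by nlinarith [mul_nonneg hN hε₀]
  rw [toC_plaqHol_qU hj]
  have hexp : |argB (Complex.exp (((loopAvg U ⟨q.src, q.μ⟩ + loopAvg U ⟨q.src.shift q.μ, q.ν⟩ -
      loopAvg U ⟨q.src.shift q.ν, q.μ⟩ - loopAvg U ⟨q.src, q.ν⟩ : ℝ) : ℂ) * I))| ≤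
      4 * ((((P.L - 1) * ((P.d - 1) * (P.L - 1)) + (P.d - 1) * (P.L - 1) * (1 + 2 * ((P.d - 1) * (P.L - 1))) : ℕ) : ℝ) * ε) := by
    rwa [argB_exp_of_abs_lt hθπ]
  calc _ ≤ (P.L : ℝ) ^ 2 * ε +
        4 * ((((P.L - 1) * ((P.d - 1) * (P.L - 1)) + (P.d - 1) * (P.L - 1) * (1 + 2 * ((P.d - 1) * (P.L - 1))) : ℕ) : ℝ) * ε) :=
        abs_argB_mul_le hn (Complex.norm_exp_ofReal_mul_I _) ha hexp (by nlinarith)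
    _ = _ := by ring

/-! ## §5  `|f(p′)| ≦ cp(e_k)`: the field strength of `v = Qu` is small — r16's `SmallF` discharged -/

/-- **The field strength (3.26) of a unit number with a small phase**: `‖(ie_k)^{−1} log z‖ = |argB z|/e_k` for `‖z‖ = 1`,
`|argB z| < π` (principal logarithm = the branch (2.11) away from the cut). [cite: BalabanImbrieJaffe1988, (3.26) p.269] -/
theorem norm_fieldStrength_eq {ek : ℝ} (hek : 0 < ek) {z : ℂ} (hz : ‖z‖ = 1) (hπ : |argB z| < π) :
    ‖fieldStrength ek z‖ = |argB z| / ek := by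
  have e0 : ek * (argB z / ek) = argB z := by field_simp
  have e1 : Complex.exp (I * ((ek * (argB z / ek) : ℝ) : ℂ)) = z := by
    rw [e0, mul_comm, exp_argB_mul_I_of_norm hz]
  have h2 : |ek * (argB z / ek)| < π := by rwa [e0]
  have e2 : fieldStrength ek z = ((argB z / ek : ℝ) : ℂ) := by
    conv_lhs => rw [← e1]
    exact BIJ88Sect3Translations.fieldStrength_exp_of_small hek.ne' h2
  rw [e2, Complex.norm_real, Real.norm_eq_abs, abs_div, abs_of_pos hek]

/-- kernel: `c = L² + 4N₃ ≤ 17d²L²`. [cite: BalabanImbrieJaffe1988, (5.3.1) p.280] -/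
theorem const_le_seventeen :
    P.L ^ 2 + 4 * ((P.L - 1) * ((P.d - 1) * (P.L - 1)) + (P.d - 1) * (P.L - 1) * (1 + 2 * ((P.d - 1) * (P.L - 1)))) ≤
      17 * P.d ^ 2 * P.L ^ 2 := by
  have hd := P.hd
  have hL := P.hL.2
  set a := (P.d - 1) * (P.L - 1) with ha
  have ha1 : a ≤ P.d * P.L := Nat.mul_le_mul (Nat.sub_le _ _) (Nat.sub_le _ _)
  have hL1 : P.L - 1 ≤ P.L := Nat.sub_le _ _
  have hdd : P.d ≤ P.d ^ 2 := by nlinarith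
  have hLL : P.L ≤ P.L ^ 2 := by nlinarith
  have k1 : P.L ^ 2 ≤ P.d ^ 2 * P.L ^ 2 := Nat.le_mul_of_pos_left _ (by positivity)
  have k2 : P.d * P.L ^ 2 ≤ P.d ^ 2 * P.L ^ 2 := Nat.mul_le_mul_right _ hdd
  have k3 : P.d * P.L ≤ P.d ^ 2 * P.L ^ 2 := Nat.mul_le_mul hdd hLL
  calc P.L ^ 2 + 4 * ((P.L - 1) * a + a * (1 + 2 * a))
      ≤ P.L ^ 2 + 4 * (P.L * (P.d * P.L) + (P.d * P.L) * (1 + 2 * (P.d * P.L))) := by gcongr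
    _ = P.L ^ 2 + 4 * (P.d * P.L ^ 2) + 4 * (P.d * P.L) + 8 * (P.d ^ 2 * P.L ^ 2) := by ring
    _ ≤ 17 * P.d ^ 2 * P.L ^ 2 := by linarith

/-- **THE SECOND p. 280 SENTENCE, `c = 17d²L²`** — r16's asserted predicate `SmallF` (row C2.Eq5.3.1-5.3.7) DISCHARGED: in the axial
gauge, if for every plaquette `p′` of `Λ₀′**` the fine plaquettes of the four blocks around `p′` satisfy `|argB u(∂p)| ≤ e_kp(e_k)`
(*"the restrictions on u(p)"*, inside `Λ₀^{(k)**}` in the paper's geometry) and `17d²L²e_kp(e_k) < π`, then the field strength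
`f(p′) = (ie_k)^{−1} log v(p′)` of **`v = Qu`** satisfies *"|f(p)| ≦ cp(e_k) for p ∈ Λ₀^{(k)′*}"* with `c = 17d²L²`.
[cite: BalabanImbrieJaffe1988, (5.3.1) p.280] -/
theorem smallF_of_plaquettes (hj : j + 1 ≤ P.m + P.K) {U : GaugeField P j U1} (hU : DeltaAx U) {ek pek : ℝ}
    (hek : 0 < ek) (hpek : 0 ≤ pek) (Λ0' : Finset (Balaban1983to89.Site P (j+1)))
    (hε : ∀ q ∈ starP Λ0', ∀ p : Balaban1983to89.Plaq P j, blockOf p.src = q.src ∨ blockOf p.src = q.src.shift q.μ ∨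
      blockOf p.src = q.src.shift q.ν ∨ blockOf p.src = (q.src.shift q.μ).shift q.ν → |argB (toC (plaqHol U p))| ≤ ek * pek)
    (hπ : 17 * (P.d : ℝ) ^ 2 * (P.L : ℝ) ^ 2 * (ek * pek) < π) :
    BIJ88Sect5StatementsPart3.SmallF (17 * (P.d : ℝ) ^ 2 * (P.L : ℝ) ^ 2) pek ek Λ0' (fun q => toC (plaqHol (qU U) q)) := by
  intro q hq
  have hle : ((P.L ^ 2 + 4 * ((P.L - 1) * ((P.d - 1) * (P.L - 1)) + (P.d - 1) * (P.L - 1) * (1 + 2 * ((P.d - 1) * (P.L - 1))))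
      : ℕ) : ℝ) ≤ 17 * (P.d : ℝ) ^ 2 * (P.L : ℝ) ^ 2 := by exact_mod_cast const_le_seventeen
  have hle' := mul_le_mul_of_nonneg_right hle (mul_nonneg hek.le hpek)
  have h := (abs_argB_plaqHol_qU_le hj hU (mul_nonneg hek.le hpek) q (hε q hq) (lt_of_le_of_lt hle' hπ)).trans hle'
  have hlt : |argB (toC (plaqHol (qU U) q))| < π := lt_of_le_of_lt h hπ
  dsimp only
  rw [norm_fieldStrength_eq hek (norm_toC _) hlt, div_le_iff₀ hek]
  calc |argB (toC (plaqHol (qU U) q))| ≤ 17 * (P.d : ℝ) ^ 2 * (P.L : ℝ) ^ 2 * (ek * pek) := h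
    _ = 17 * (P.d : ℝ) ^ 2 * (P.L : ℝ) ^ 2 * pek * ek := by ring

end

end Literature.MathematicalPhysics.QuantumFieldTheory.BalabanImbrieJaffe1984to88.BIJ88Eq531SmallF
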